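import Summits.Ventures.DiscreteObjects.STD.DoubleCoverCertificate

/-!
# ZC-2 as a theorem: no normalised regular double cover of the STD₄[12;3] D(A) is an STD₂[12;6]
Framing: lottery ticket; floor = certified bounds/negative ranges.

Cell pub-namedobj (target M, family F-INV2 / ZCOVER, designs g5). `DoubleCoverCertificate` (p235552) makes the kernel EVALUATE
the decision procedure; this file turns the evaluation into the THEOREM `no_normalised_double_cover`: no Z₂-voltage `φ` on
the 432 flags of D(A) with `φ(0,j,x) = φ(i,0,x) = 0` (bitset `m`, bit `(12 i + j)·3 + x`) satisfies the 1188 two-of-four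
constraints — so (FAMILY-ZCOVER §1: every STD₂[12;6] with a class-fixing involution is such a cover of the unique STD₄[12;3],
Suetake 2005, and sheet relabelings normalise it) no STD₂[12;6] admits a class-fixing automorphism of order 2, and there is no
generalized Hadamard matrix of order 12 over a group of order 6.
Architecture (certificate style; nothing about Gauss–Jordan is trusted or proved): the kernel re-runs the elimination WITH
PROVENANCE (`gjLoopP`) and `certP_ok` checks, for every non-free position `v`, that `pivotRow v` of the certificate file IS
the XOR (`xorSel`) of the input rows named by its provenance and meets the non-free positions below 432 exactly in `{v}`; the
parity functional `ev` is additive, vanishes on the input rows of a normalised solution (two-of-four ⟹ parity), hence on the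
pivot rows, which gives `m.testBit v = G m (pivotRow v)` (`testBit_eq_G`); so `m` agrees below 432 with `coset (freeBits m)`
(`agree`), the constraints only read bits below 432 (`isSTD2cover_of_agree`), and `cosets_ok` finishes the proof.
-/

namespace Summit.Ventures.DiscreteObjects.STD.ZC2

/-! ## The certified elimination with provenance (computations) -/
/-- block width for rows with provenance: 432 coefficient bits + 1257 provenance bits -/
def WP : Nat := 1689

/-- rows with provenance units, packed: row `r` = `inputRows[r] + 2^(432+r)` in block `r` of width `WP` -/
def packedRowsP : Nat :=
  (inputRows.foldl (fun (acc : Nat × Nat) row => (acc.1 ||| ((row ||| 2 ^ (432 + acc.2)) <<< (WP * acc.2)), acc.2 + 1))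
    (0, 0)).1

/-- `Σ_{r<n} 2^{WP r}` -/
def strideOnesP (n : Nat) : Nat := (2 ^ (WP * n) - 1) / (2 ^ WP - 1)

/-- one elimination step at position `v < 432` on `(M, Piv)` (as `gjStep`, block width `WP`; provenance bits ride along) -/
def gjStepP (v : Nat) (st : Nat × Nat) : Nat × Nat :=
  let M := st.1
  let S := M &&& (strideOnesP R <<< v)
  bif S == 0 then st else
    let P := (M / ((((S ^^^ (S - 1)) + 1) / 2) >>> v)) &&& (2 ^ WP - 1)
    let Sp := st.2 &&& (strideOnesP 432 <<< v)
    (M ^^^ P * (S >>> v), (st.2 ^^^ P * (Sp >>> v)) ||| (P <<< (WP * v)))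

/-- the elimination loop over positions `v, v+1, …` -/
def gjLoopP : Nat → Nat → Nat × Nat → Nat × Nat
  | 0, _, st => st
  | fuel + 1, v, st => gjLoopP fuel (v + 1) (gjStepP v st)

/-- packed pivot rows with provenance -/
def pivP : Nat := (gjLoopP 432 0 (packedRowsP, 0)).2

/-- provenance of the pivot row at position `v` (bit `r` set = input row `r` was used) -/
def provOf (v : Nat) : Nat := ((pivP >>> (WP * v)) &&& (2 ^ WP - 1)) >>> 432

/-- XOR of the rows of `rows` selected by the bits `k, k+1, …` of `prov` -/
def xorSel (prov : Nat) : List Nat → Nat → Nat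
  | [], _ => 0
  | r :: l, k => (bif prov.testBit k then r else 0) ^^^ xorSel prov l (k + 1)

/-- bitset of the nine free positions -/
def freeMask : Nat := freeExpected.foldr (fun f acc => 2 ^ f ^^^ acc) 0

/-- bitset of the non-free positions below 432 -/
def nonFreeMask : Nat := (2 ^ 432 - 1) ^^^ freeMask

/-- certificate of the row of a non-free position `v`: the certificate file's `pivotRow v` is the XOR of the input rows named by
its provenance, and among the non-free positions below 432 it contains exactly `v` -/
def certRow (v : Nat) : Bool :=
  (xorSel (provOf v) inputRows 0 == pivotRow v) && ((pivotRow v &&& nonFreeMask) == 2 ^ v)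

/-- all 423 non-free positions are certified -/
def certP : Bool := (List.range 432).all fun v => freeExpected.elem v || certRow v

set_option maxRecDepth 100000 in
/-- **kernel:** every non-free position has a certified row. -/
theorem certP_ok : certP = true := by
  decide +kernel

/-! ## Parity functional -/
/-- parity of the bits of `m` selected by `Y` among the positions `< n` -/
def ev (m Y : Nat) : Nat → Bool
  | 0 => false
  | n + 1 => xor (ev m Y n) (m.testBit n && Y.testBit n)

/-- the zero mask selects nothing -/
theorem ev_zero_mask (m n : Nat) : ev m 0 n = false := by
  induction n with
  | zero => rfl
  | succ n ih => simp [ev, ih]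

/-- `ev` is additive in the mask -/
theorem ev_xor (m Y Z n : Nat) : ev m (Y ^^^ Z) n = xor (ev m Y n) (ev m Z n) := by
  induction n with
  | zero => rfl
  | succ n ih =>
    simp only [ev, ih, Nat.testBit_xor]
    cases ev m Y n <;> cases ev m Z n <;> cases m.testBit n <;> cases Y.testBit n <;> cases Z.testBit n <;> rfl

/-- `ev` of a unit mask reads one bit -/
theorem ev_two_pow (m a n : Nat) : ev m (2 ^ a) n = (decide (a < n) && m.testBit a) := by
  induction n with
  | zero => simp [ev]
  | succ n ih =>
    simp only [ev, ih, Nat.testBit_two_pow]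
    by_cases h : a = n
    · subst h
      have h1 : decide (a < a) = false := by simp
      have h2 : decide (a < a + 1) = true := by simp
      rw [h1, h2]; simp
    · have h1 : decide (a = n) = false := by simp [h]
      have h2 : decide (a < n + 1) = decide (a < n) := by
        by_cases h3 : a < n
        · simp [h3, Nat.lt_succ_of_lt h3]
        · have : ¬ a < n + 1 := by omega
          simp [h3, this]
      rw [h1, h2]; cases decide (a < n) <;> cases m.testBit a <;> simp

/-- `ev` of a mask cut down to one position -/
theorem ev_and_two_pow (m Y a n : Nat) : ev m (Y &&& 2 ^ a) n = (decide (a < n) && (m.testBit a && Y.testBit a)) := by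
  induction n with
  | zero => simp [ev]
  | succ n ih =>
    simp only [ev, ih, Nat.testBit_land, Nat.testBit_two_pow]
    by_cases h : a = n
    · subst h
      have h1 : decide (a < a) = false := by simp
      have h2 : decide (a < a + 1) = true := by simp
      rw [h1, h2]; cases m.testBit a <;> cases Y.testBit a <;> simp
    · have h1 : decide (a = n) = false := by simp [h]
      have h2 : decide (a < n + 1) = decide (a < n) := by
        by_cases h3 : a < n
        · simp [h3, Nat.lt_succ_of_lt h3]
        · have : ¬ a < n + 1 := by omega
          simp [h3, this]
      rw [h1, h2]; cases decide (a < n) <;> cases m.testBit a <;> cases Y.testBit a <;> simp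

/-- `ev` only reads the bits below `n` of the mask -/
theorem ev_and_low (m Y N : Nat) : ∀ n, n ≤ N → ev m (Y &&& (2 ^ N - 1)) n = ev m Y n := by
  intro n
  induction n with
  | zero => intro; rfl
  | succ n ih =>
    intro hn
    simp only [ev, ih (Nat.le_of_succ_le hn), Nat.testBit_land, Nat.testBit_two_pow_sub_one]
    have : decide (n < N) = true := by simp; omega
    rw [this]; cases Y.testBit n <;> simp

/-! ## From two-of-four to parity -/
/-- `ev` of the parity mask of a constraint is the XOR of its difference bits -/
theorem ev_maskOf (m : Nat) (c : List (Nat × Nat)) (hc : ∀ p ∈ c, p.1 < 432 ∧ p.2 < 432) :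
    ev m (maskOf c) 432 = c.foldr (fun p acc => xor (diffBit m p) acc) false := by
  induction c with
  | nil => simp [maskOf, ev_zero_mask]
  | cons p l ih =>
    have hp := hc p (by simp)
    have hl : ∀ q ∈ l, q.1 < 432 ∧ q.2 < 432 := fun q hq => hc q (by simp [hq])
    simp only [maskOf, ev_xor, ev_two_pow, ih hl, List.foldr, diffBit, hp.1, hp.2, decide_true, Bool.true_and]

/-- an XOR-fold is the parity of the count -/
theorem foldr_xor_eq_decide {α : Type} (f : α → Bool) (l : List α) :
    l.foldr (fun p acc => xor (f p) acc) false = decide (l.countP f % 2 = 1) := by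
  induction l with
  | nil => simp
  | cons a l ih =>
    simp only [List.foldr, ih, List.countP_cons]
    cases f a
    · simp
    · simp only [ite_true, Bool.true_xor]
      rcases Nat.mod_two_eq_zero_or_one (List.countP f l) with h | h
      · have : (List.countP f l + 1) % 2 = 1 := by omega
        simp [h, this]
      · have : (List.countP f l + 1) % 2 = 0 := by omega
        simp [h, this]

/-- two-of-four implies even parity -/
theorem ev_maskOf_of_twoOfFour (m : Nat) (c : List (Nat × Nat)) (hc : ∀ p ∈ c, p.1 < 432 ∧ p.2 < 432)
    (h2 : twoOfFour m c = true) : ev m (maskOf c) 432 = false := by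
  rw [ev_maskOf m c hc, foldr_xor_eq_decide]
  have : c.countP (fun p => diffBit m p) = 2 := by simpa [twoOfFour] using h2
  simp [this]

/-! ## Rows in the span of the input rows -/
/-- `ev` vanishes on every XOR of rows on which it vanishes -/
theorem ev_xorSel (m prov N : Nat) (rows : List Nat) (h : ∀ r ∈ rows, ev m r N = false) :
    ∀ k, ev m (xorSel prov rows k) N = false := by
  induction rows with
  | nil => intro k; simp [xorSel, ev_zero_mask]
  | cons r l ih =>
    intro k
    have hr := h r (by simp)
    have hl : ∀ r' ∈ l, ev m r' N = false := fun r' hr' => h r' (by simp [hr'])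
    simp only [xorSel, ev_xor, ih hl (k + 1)]
    cases prov.testBit k <;> simp [hr, ev_zero_mask]

/-- all flags of all constraints are below 432 (from `data_ok`) -/
theorem indices_ok : ∀ c ∈ allCons, ∀ p ∈ c, p.1 < 432 ∧ p.2 < 432 := by
  have h := data_ok
  simp only [Bool.and_eq_true, List.all_eq_true, decide_eq_true_eq] at h
  intro c hc p hp
  exact (h.2 c hc).2 p hp

/-- `ev` of a normalised solution vanishes on every input row -/
theorem ev_inputRows (m : Nat) (hn : ∀ u ∈ normVars, m.testBit u = false) (hc : isSTD2cover m = true) :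
    ∀ r ∈ inputRows, ev m r 432 = false := by
  intro r hr
  simp only [inputRows, List.mem_append, List.mem_map] at hr
  rcases hr with ⟨c, hcm, rfl⟩ | ⟨u, hu, rfl⟩
  · have h2 : twoOfFour m c = true := by
      have h' := hc
      simp only [isSTD2cover, List.all_eq_true] at h'
      exact h' c hcm
    exact ev_maskOf_of_twoOfFour m c (indices_ok c hcm) h2
  · rw [ev_two_pow]
    simp [hn u hu]

/-! ## The free-bit functional and the bit identity at a certified position -/
/-- XOR over the nine free positions `f` of `m_f ∧ Y_f` -/
def G (m Y : Nat) : Bool := freeExpected.foldr (fun f acc => xor (m.testBit f && Y.testBit f) acc) false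

/-- the free positions are below 432 -/
theorem free_lt : ∀ f ∈ freeExpected, f < 432 := by decide

/-- `ev` of a mask cut down to a list of positions -/
theorem ev_and_foldr (m Y : Nat) (L : List Nat) (hL : ∀ f ∈ L, f < 432) :
    ev m (Y &&& L.foldr (fun f acc => 2 ^ f ^^^ acc) 0) 432 =
      L.foldr (fun f acc => xor (m.testBit f && Y.testBit f) acc) false := by
  induction L with
  | nil => simp [ev_zero_mask]
  | cons f L ih =>
    have hf := hL f (by simp)
    have hL' : ∀ f' ∈ L, f' < 432 := fun f' h' => hL f' (by simp [h'])
    simp only [List.foldr, Nat.and_xor_distrib_left, ev_xor, ev_and_two_pow, ih hL', hf, decide_true, Bool.true_and]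

/-- `ev` of a mask cut down to the free positions is `G` -/
theorem ev_and_freeMask (m Y : Nat) : ev m (Y &&& freeMask) 432 = G m Y :=
  ev_and_foldr m Y freeExpected free_lt

/-- the low 432 bits split into non-free and free positions -/
theorem low_eq_xor : (2 ^ 432 - 1 : Nat) = nonFreeMask ^^^ freeMask := by
  rw [nonFreeMask, Nat.xor_assoc, Nat.xor_self, Nat.xor_zero]

/-- the bit identity at a certified non-free position -/
theorem testBit_eq_G (m v : Nat) (hv : v < 432) (hin : ∀ r ∈ inputRows, ev m r 432 = false)
    (hcert : certRow v = true) : m.testBit v = G m (pivotRow v) := by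
  simp only [certRow, Bool.and_eq_true, beq_iff_eq] at hcert
  obtain ⟨hsel, hshape⟩ := hcert
  have h0 : ev m (pivotRow v) 432 = false := by
    rw [← hsel]; exact ev_xorSel m (provOf v) 432 inputRows hin 0
  have h1 : ev m (pivotRow v) 432 = xor (decide (v < 432) && m.testBit v) (G m (pivotRow v)) := by
    rw [← ev_and_low m (pivotRow v) 432 432 (Nat.le_refl _), low_eq_xor, Nat.and_xor_distrib_left, ev_xor, hshape,
      ev_two_pow, ev_and_freeMask]
  rw [h1] at h0
  simp only [hv, decide_true, Bool.true_and] at h0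
  cases h : m.testBit v <;> cases h' : G m (pivotRow v) <;> simp [h, h'] at h0 ⊢

/-! ## Bits of the cosets of the certificate file -/
/-- bits of a conditional mask -/
theorem testBit_bif_zero (c : Bool) (q w : Nat) : (bif c then q else 0).testBit w = (c && q.testBit w) := by
  cases c <;> simp

/-- bits of the conditional XOR-fold used by `basisVec` -/
theorem testBit_foldl_range (P : Nat → Bool) (init w : Nat) :
    ∀ n, ((List.range n).foldl (fun acc v => bif P v then acc ^^^ 2 ^ v else acc) init).testBit w =
      xor (init.testBit w) (decide (w < n) && P w) := by
  intro n
  induction n with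
  | zero => simp
  | succ n ih =>
    rw [List.range_succ, List.foldl_append, List.foldl_cons, List.foldl_nil]
    by_cases hw : w = n
    · subst hw
      cases hP : P w
      · simp [ih, hP]
      · simp only [cond_true, Nat.testBit_xor, ih, Nat.testBit_two_pow]
        have h1 : decide (w < w) = false := by simp
        have h2 : decide (w < w + 1) = true := by simp
        rw [h1, h2]; cases init.testBit w <;> simp
    · have h2 : decide (w < n + 1) = decide (w < n) := by
        by_cases h3 : w < n
        · simp [h3, Nat.lt_succ_of_lt h3]
        · have : ¬ w < n + 1 := by omega
          simp [h3, this]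
      cases hP : P n
      · simp [ih, h2]
      · simp only [cond_true, Nat.testBit_xor, ih, Nat.testBit_two_pow, h2]
        have : decide (n = w) = false := by simp [Ne.symm hw]
        rw [this]; cases xor (init.testBit w) (decide (w < n) && P w) <;> rfl

/-- bits of a basis vector of the certificate file -/
theorem testBit_basisVec (f w : Nat) :
    (basisVec f).testBit w = xor (decide (f = w)) (decide (w < 432) && ((pivotRow w).testBit f && !(freeExpected.elem w))) := by
  rw [basisVec, testBit_foldl_range, Nat.testBit_two_pow]

/-- the nine free bits of `m` as a number below 512 -/
def bits9 (c0 c1 c2 c3 c4 c5 c6 c7 c8 : Bool) : Nat :=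
  (bif c0 then 1 else 0) ||| (bif c1 then 2 else 0) ||| (bif c2 then 4 else 0) ||| (bif c3 then 8 else 0) |||
  (bif c4 then 16 else 0) ||| (bif c5 then 32 else 0) ||| (bif c6 then 64 else 0) ||| (bif c7 then 128 else 0) |||
  (bif c8 then 256 else 0)

/-- free bits of `m` -/
def freeBits (m : Nat) : Nat :=
  bits9 (m.testBit 386) (m.testBit 392) (m.testBit 395) (m.testBit 416) (m.testBit 422) (m.testBit 425) (m.testBit 426)
    (m.testBit 427) (m.testBit 428)

/-- `bits9` is below 512 -/
theorem bits9_lt (c0 c1 c2 c3 c4 c5 c6 c7 c8 : Bool) : bits9 c0 c1 c2 c3 c4 c5 c6 c7 c8 < 512 := by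
  unfold bits9
  cases c0 <;> cases c1 <;> cases c2 <;> cases c3 <;> cases c4 <;> cases c5 <;> cases c6 <;> cases c7 <;> cases c8 <;> decide

/-- the bits of `bits9` -/
theorem bits9_testBit (c0 c1 c2 c3 c4 c5 c6 c7 c8 : Bool) :
    (bits9 c0 c1 c2 c3 c4 c5 c6 c7 c8).testBit 0 = c0 ∧ (bits9 c0 c1 c2 c3 c4 c5 c6 c7 c8).testBit 1 = c1 ∧
    (bits9 c0 c1 c2 c3 c4 c5 c6 c7 c8).testBit 2 = c2 ∧ (bits9 c0 c1 c2 c3 c4 c5 c6 c7 c8).testBit 3 = c3 ∧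
    (bits9 c0 c1 c2 c3 c4 c5 c6 c7 c8).testBit 4 = c4 ∧ (bits9 c0 c1 c2 c3 c4 c5 c6 c7 c8).testBit 5 = c5 ∧
    (bits9 c0 c1 c2 c3 c4 c5 c6 c7 c8).testBit 6 = c6 ∧ (bits9 c0 c1 c2 c3 c4 c5 c6 c7 c8).testBit 7 = c7 ∧
    (bits9 c0 c1 c2 c3 c4 c5 c6 c7 c8).testBit 8 = c8 := by
  unfold bits9
  cases c0 <;> cases c1 <;> cases c2 <;> cases c3 <;> cases c4 <;> cases c5 <;> cases c6 <;> cases c7 <;> cases c8 <;> decide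

/-- bit `w` of `coset b`, unfolded over the nine basis vectors -/
theorem testBit_coset (b w : Nat) : (coset b).testBit w =
    xor (b.testBit 0 && (basisVec 386).testBit w) (xor (b.testBit 1 && (basisVec 392).testBit w)
    (xor (b.testBit 2 && (basisVec 395).testBit w) (xor (b.testBit 3 && (basisVec 416).testBit w)
    (xor (b.testBit 4 && (basisVec 422).testBit w) (xor (b.testBit 5 && (basisVec 425).testBit w)
    (xor (b.testBit 6 && (basisVec 426).testBit w) (xor (b.testBit 7 && (basisVec 427).testBit w)
    (xor (b.testBit 8 && (basisVec 428).testBit w) false)))))))) := by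
  simp only [coset, basis, freeExpected, List.map, cosetOf, Nat.testBit_xor, testBit_bif_zero, Nat.zero_testBit]

/-- a normalised solution agrees below 432 with the coset of its free bits -/
theorem agree (m : Nat) (hin : ∀ r ∈ inputRows, ev m r 432 = false) :
    ∀ w, w < 432 → m.testBit w = (coset (freeBits m)).testBit w := by
  intro w hw
  have hcP := certP_ok
  simp only [certP, List.all_eq_true, List.mem_range, Bool.or_eq_true] at hcP
  obtain ⟨e0, e1, e2, e3, e4, e5, e6, e7, e8⟩ := bits9_testBit (m.testBit 386) (m.testBit 392) (m.testBit 395)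
    (m.testBit 416) (m.testBit 422) (m.testBit 425) (m.testBit 426) (m.testBit 427) (m.testBit 428)
  rw [testBit_coset]
  simp only [freeBits]
  rw [e0, e1, e2, e3, e4, e5, e6, e7, e8]
  by_cases hfree : freeExpected.elem w = true
  · -- `w` is one of the nine free positions
    have hmem : w ∈ freeExpected := List.mem_of_elem_eq_true hfree
    simp only [freeExpected, List.mem_cons, List.mem_nil_iff, or_false] at hmem
    rcases hmem with rfl | rfl | rfl | rfl | rfl | rfl | rfl | rfl | rfl <;>
      simp [testBit_basisVec, freeExpected]
  · have hf : freeExpected.elem w = false := by simpa using hfree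
    rcases hcP w hw with h | h
    · rw [h] at hf; exact absurd hf (by simp)
    · rw [testBit_eq_G m w hw hin h]
      have d : ∀ f, freeExpected.elem f = true → decide (f = w) = false := fun f hfm =>
        decide_eq_false fun h' => by subst h'; rw [hfm] at hf; exact Bool.noConfusion hf
      have d0 := d 386 (by decide); have d1 := d 392 (by decide); have d2 := d 395 (by decide)
      have d3 := d 416 (by decide); have d4 := d 422 (by decide); have d5 := d 425 (by decide)
      have d6 := d 426 (by decide); have d7 := d 427 (by decide); have d8 := d 428 (by decide)
      simp only [testBit_basisVec, hw, hf, d0, d1, d2, d3, d4, d5, d6, d7, d8, decide_true, Bool.true_and, Bool.and_true,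
        Bool.not_false, Bool.false_xor]
      simp only [G, freeExpected, List.foldr]

/-! ## The constraints only read bits below 432 -/
/-- `countP` only depends on the predicate on members -/
theorem countP_congr_mem {α : Type} (p q : α → Bool) (l : List α) (h : ∀ x ∈ l, p x = q x) :
    l.countP p = l.countP q := by
  induction l with
  | nil => simp
  | cons a l ih =>
    rw [List.countP_cons, List.countP_cons, h a (by simp), ih (fun x hx => h x (by simp [hx]))]

/-- the STD₂[12;6] constraints only read the bits below 432 -/
theorem isSTD2cover_of_agree (a a' : Nat) (h : ∀ w, w < 432 → a.testBit w = a'.testBit w)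
    (ha : isSTD2cover a = true) : isSTD2cover a' = true := by
  simp only [isSTD2cover, List.all_eq_true] at ha ⊢
  intro c hc
  have h2 := ha c hc
  have hidx := indices_ok c hc
  have hcount : c.countP (fun p => diffBit a p) = c.countP (fun p => diffBit a' p) :=
    countP_congr_mem _ _ c (fun p hp => by
      simp only [diffBit, h p.1 (hidx p hp).1, h p.2 (hidx p hp).2])
  simp only [twoOfFour] at h2 ⊢
  rw [← hcount]; exact h2

/-! ## The theorem -/
/-- `cosets_ok` of the certificate file, unpacked -/
theorem coset_not_cover (b : Nat) (hb : b < 512) : isSTD2cover (coset b) = false := by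
  have h := cosets_ok
  simp only [cosetsOK, List.all_eq_true, List.mem_range, Bool.not_eq_true'] at h
  exact h b hb

/-- **ZC-2 (theorem).** No normalised Z₂-voltage on the flags of D(A) (bitset `m`, bit `(12 i + j)·3 + x` = `φ(i,j,x)`,
`φ(0,j,x) = φ(i,0,x) = 0`) makes the double cover an STD₂[12;6]: the 1188 two-of-four constraints cannot all hold. -/
theorem no_normalised_double_cover (m : Nat) (hn : ∀ u ∈ normVars, m.testBit u = false)
    (hc : isSTD2cover m = true) : False := by
  have hin := ev_inputRows m hn hc
  have h1 : isSTD2cover (coset (freeBits m)) = true := isSTD2cover_of_agree m _ (agree m hin) hc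
  have h2 : isSTD2cover (coset (freeBits m)) = false := coset_not_cover _ (bits9_lt _ _ _ _ _ _ _ _ _)
  rw [h1] at h2
  exact Bool.noConfusion h2
end Summit.Ventures.DiscreteObjects.STD.ZC2

/-! Literature note (appended 2026-08-20): the Z₆ corollary above RE-DERIVES Lampio 2015 (Aalto diss., Table 6.1; Lampio–Östergård, JSPI 141 (2011)): no GH(12, Z₆). Provisional (not found in print): the S₃ case and the STD-level theorem of this file. -/
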